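/-
Copyright (c) 2026 the pub-hodgecm-mathlib formalisation cell (harness21).  Prover seat hodgecm-mathlib-LH5-p04 (g10); LEAD F0P3a-plan (g16) T15-25 (b)(c) «the tame case of
EP-PAIRS is a CASE SPLIT inside ONE assembly, not a column of twins» — this file IS that case split, done once, in the letters of ★ (G3)-EXPLICIT; G-row dealer F0P3a-p09 (g14);
2026-09-03.
-/
import Summits.HodgeConjecture.HodgeConjecture.Theorems.F0P3cStCharTSEPGlueGExplicit          -- ★ p853069 ∕ ED. 2 p853141 (LH10-p02): `epFunction_G_explicit` (unramified datum); brings ★ (G3) + ★ `unramifiedLocalConjDatum_adicCompletion`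
import Summits.HodgeConjecture.HodgeConjecture.Theorems.F0P3cStCharTSEPGlueGExplicitRamified  -- ★ p853167 (this seat): `epFunction_G_explicit_of_ramified` (tame block as binders)
import Summits.HodgeConjecture.HodgeConjecture.Theorems.F0P3cStCharTSEPGlueGNotWild           -- ★ p853093 (F0P3a-p09): brings ★ `ramifiedBlock_adicCompletion`, ★ `isUnramifiedIn_of_ramificationIdx'_eq_one`, ★ `valued_two_eq_one_iff_of_placesOver`
import HarnessLib

/-!
# F0 · P3c · line LH6 «StCharTS» — «(G3)-EXPLICIT-NOT-WILD»: ONE UNIFORMISER `ϖ` OF `L_w` FOR WHICH THE DISPLAYED `f_EP` HAS ITS EIGHT CLAUSES, AT EVERY NON-SPLIT PLACE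
# THAT IS NOT WILDLY RAMIFIED [Kottwitz1988 §2 Thm. 2; Rogawski1990 §12.6 p. 187; Tits1979 §2.4]

Cell `pub/hodgecm-mathlib`, crux H413 = `stmt-HodgeConjecture-24833` (lane `--kind proof --supports … --as helper`), route HCCMUnconditional.  THEOREMS ONLY (no definition ∕
instance ∕ notation ∕ named fact ∕ `sorry`); ★-only imports; count-neutral (closes no node; no rider implied).

WHAT.  ★ (G3)-EXPLICIT `epFunction_G_explicit` (unramified `v`, datum `hd : UnramifiedLocalConjDatum σ_w ϖ`) and ★ (G3)-EXPLICIT-RAM `epFunction_G_explicit_of_ramified`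
(tame block `hϖ hσϖ hres h2w hnorm`) conclude the SAME eight clauses for the SAME displayed function `fG = νQv(K₀)⁻¹𝟙_{K₀} + νQv(K₁)⁻¹𝟙_{K₁} − νQv(I)⁻¹𝟙_I` in the SAME letters
`(g₁) (hg₁ : g₁ = diag(1,1,ϖ)) (eA) (heA) (K0 K1 I) (hK0) (hK1) (hI) (fG) (hfG)`; they differ only in WHICH uniformiser `ϖ` of `L_w` the edge matrix `g₁` carries (`σ_w ϖ = ϖ`
unramified, `σ_w ϖ = −ϖ` tame).  An assembly that wants ONE code path at every non-split place that is not wildly ramified (LEAD T15-25 (b)(c): head binder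
`Algebra.IsUnramifiedIn (𝓞 L) 𝔭_v ∨ |2|_v = 1`, «two `obtain`s inside») needs exactly: SOME uniformiser `ϖ` (`|ϖ|_w = exp(−1)` — the only fact the place-free (G6)-ST ranks
read) such that FOR ALL letters built on it the eight clauses hold.  This file states and proves that `∃ ϖ, |ϖ|_w = exp(−1) ∧ ∀ letters, ‹eight clauses›` by the case split of
★ (G3)-NOT-WILD `exists_epFunction_G_of_ramificationIdx'_or_valued_two` ∕ `…_of_not_wild` (F0P3a-p09), re-run one level up: `e(w|v) = 1` ⇒ unramified (★
`isUnramifiedIn_of_ramificationIdx'_eq_one`) ⇒ datum ★ `unramifiedLocalConjDatum_adicCompletion` ⇒ ★ `epFunction_G_explicit`; `e(w|v) ≠ 1 ∧ |2|_w = 1` ⇒ block ★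
`ramifiedBlock_adicCompletion` ⇒ ★ `epFunction_G_explicit_of_ramified`.  No new mathematics.

* §1 `exists_uniformizer_epFunction_G_explicit_of_ramificationIdx'_or_valued_two` — at the place `w ∣ v` with `e(w|v) = 1 ∨ |2|_w = 1`, for any one-place model `(eA, heA)`.
* §2 `exists_uniformizer_epFunction_G_explicit_of_not_wild` — the same in `L⁺_v`-letters `Algebra.IsUnramifiedIn (𝓞 L) 𝔭_v ∨ |2|_v = 1` (★ `valued_two_eq_one_iff_of_placesOver`).

CONSUMER SHAPE (one path, no case split left): `obtain ⟨ϖ, hϖ, hEP⟩ := exists_uniformizer_epFunction_G_explicit_of_not_wild L v hns hv w hw eA heA νQv hcanQ`, then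
`g₁ := glDiagonal 3 _ ![1, 1, Units.mk0 ϖ _]`, `K0 K1 I fG := ‹the displays›`, `hEP g₁ hg₁ K0 K1 I rfl rfl rfl fG rfl : ‹eight clauses›`, and the (G6)-ST ranks at the same
`K0 K1 I` from their place-free heads at `hϖ` (certified re-lettering `hd ↦ hϖ`, HOME `F0/P3c/LH5/LH5-p04/g10/g6st-placefree/`) or, at an unramified `v` only, from the
datum-lettered heads.

HONEST LABEL: count-neutral input helper (UNPROVED printed rows unchanged; WILD∕dyadic ramified places stay OPEN, census G-RAM §4); h413 OPEN; HC_CM is proved only modulo the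
7 printed citations (2 remaining named inputs: hLiu418 = `stmt-HodgeConjecture-24832`, h413 = `stmt-HodgeConjecture-24833`) until rung 0 closes.

## References
* [Kottwitz1988] R. E. Kottwitz, *Tamagawa numbers*, Ann. of Math. 127 (1988), §2 Theorem 2 (Euler–Poincaré functions on a rank-one group).
* [Rogawski1990] J. D. Rogawski, *Automorphic Representations of Unitary Groups in Three Variables* (1990), §12.6 p. 187 (pseudo-coefficients).
* [Tits1979] J. Tits, *Reductive groups over local fields*, PSPM 33.1 (1979), §2.4 (local indices of `²A₂`: `(q³+1, q+1)` unramified, `(q+1, q+1)` ramified).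
* [NeukirchANT1999] J. Neukirch, *Algebraic Number Theory* (1999), Ch. I §8 Prop. (8.2) (`e = 1` at the unique place above `v` ⇒ unramified).
-/

set_option autoImplicit false
-- the mandated namespace has the single-problem summit's repeated segment (`HodgeConjecture.HodgeConjecture`)
set_option linter.dupNamespace false

noncomputable section

open NumberField IsDedekindDomain MeasureTheory Topology
open scoped Matrix MatrixGroups Valued
open Literature.NumberTheory.Rogawski1990 Literature.NumberTheory.Automorphic Literature.NumberTheory.Automorphic.UnitaryGroup
open Literature.NumberTheory.GaloisRepresentations
open Literature.NumberTheory.Automorphic.Liu2021.LemD1IndexedNonVacuityTameSynthesis (isUnramifiedIn_of_ramificationIdx'_eq_one)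
open Summit.HodgeConjecture.HodgeConjecture.Cruxes.H413.F0P3cStCharTSTorusDefs
open Summit.HodgeConjecture.HodgeConjecture.Cruxes.H413.F0P3cStCharTSEPGlueG
open Summit.HodgeConjecture.HodgeConjecture.Cruxes.H413.F0P3cStCharTSEPGlueGExplicit
open Summit.HodgeConjecture.HodgeConjecture.Cruxes.H413.F0P3cStCharTSEPGlueGExplicitRamified

namespace Summit.HodgeConjecture.HodgeConjecture.Cruxes.H413.F0P3cStCharTSEPGlueGExplicitNotWild

variable (L : Type) [Field L] [NumberField L] [IsCMField L] (v : HeightOneSpectrum (𝓞 ↥(maximalRealSubfield L)))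

/-! ## §1 The junction with the place `w ∣ v` as a binder: `e(w|v) = 1 ∨ |2|_w = 1` -/

set_option maxHeartbeats 1600000 in  -- statement-level `whnf` on the CM carriers + eight clauses, exactly as ★ (G3)-EXPLICIT `epFunction_G_explicit` and ★ (G3)-NOT-WILD §1 (measured there)
/-- **(G3)-EXPLICIT AT `w ∣ v` WITH `e(w|v) = 1 ∨ |2|_w = 1`: ONE UNIFORMISER FOR ALL LETTERS.**  For a CM field `L`, a finite place `v` of `L⁺` non-split in `L`, the place
`w ∣ v` with `e(w|v) = 1` OR `|2|_w = 1`, and ANY topological one-place model `eA : G_v ≃ₜ* U(σ_w, J₀)(L_w)` reading the matrices of ★ `localNonsplitEquiv` (`heA`), there is a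
uniformiser `ϖ` of `L_w` (`|ϖ|_w = exp(−1)`) such that for EVERY edge matrix `g₁ = diag(1, 1, ϖ)`, levels `K₀ = eA⁻¹(GL₃(𝒪_w) ∩ U)`, `K₁ = eA⁻¹(g₁ GL₃(𝒪_w) g₁⁻¹ ∩ U)`,
`I = K₀ ⊓ K₁` and `fG = νQv(K₀)⁻¹𝟙_{K₀} + νQv(K₁)⁻¹𝟙_{K₁} − νQv(I)⁻¹𝟙_I` (equations `hg₁ hK0 hK1 hI hfG`, `rfl` at the consumer) the EIGHT clauses of ★ `epFunction_G_explicit`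
hold token for token: `fG ∈ C_c^∞`, measurable, integrable, mass one, `fG 1` real negative, class orbital integral `1` at every regular class with compact centraliser and `0`
at every regular class with non-compact centraliser.  Case split: `e(w|v) = 1` ⇒ `v` unramified in `L` (★ `isUnramifiedIn_of_ramificationIdx'_eq_one`) ⇒ the unramified
datum's `ϖ` (★ `unramifiedLocalConjDatum_adicCompletion`) and ★ `epFunction_G_explicit`; `e(w|v) ≠ 1`, `|2|_w = 1` ⇒ the tame block's `ϖ` (★ `ramifiedBlock_adicCompletion`)
and ★ `epFunction_G_explicit_of_ramified`.
[cite: Kottwitz1988, §2 Theorem 2] [cite: Rogawski1990, §12.6 p. 187] [cite: Tits1979, §2.4] -/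
theorem exists_uniformizer_epFunction_G_explicit_of_ramificationIdx'_or_valued_two (hns : ∀ w : PlacesOver L v, IsCMField.complexConj L • w.1 = w.1)
    (w : PlacesOver L v) (hw : IsCMField.complexConj L • w.1 = w.1)
    (hw2 : v.asIdeal.ramificationIdx' w.1.asIdeal = 1 ∨ Valued.v (2 : w.1.adicCompletion L) = 1)
    (eA : Gqs L v ≃ₜ* ↥(unitaryGroupOfForm (galAdicCompletionMap (L := L) (IsCMField.complexConj L) hw) ((StdForm.antidiagonal 3).over (w.1.adicCompletion L))))
    (heA : ∀ g : Gqs L v,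
      ((eA g : ↥(unitaryGroupOfForm (galAdicCompletionMap (L := L) (IsCMField.complexConj L) hw) ((StdForm.antidiagonal 3).over (w.1.adicCompletion L)))) :
          GL (Fin 3) (w.1.adicCompletion L)) =
        ((localNonsplitEquiv (IsCMField.complexConj L) (qsForm L) (IsCMField.complexConj_ne_one L) w hw g :
          ↥(unitaryGroupOfForm (galAdicCompletionMap (L := L) (IsCMField.complexConj L) hw) (placeForm (qsForm L) w.1))) : GL (Fin 3) (w.1.adicCompletion L)))
    [MeasurableSpace (Gqs L v)] [BorelSpace (Gqs L v)]
    [∀ γ : Gqs L v, MeasurableSpace (Gqs L v ⧸ Subgroup.centralizer ({γ} : Set (Gqs L v)))]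
    [∀ γ : Gqs L v, BorelSpace (Gqs L v ⧸ Subgroup.centralizer ({γ} : Set (Gqs L v)))]
    (νQv : Measure (Gqs L v)) [νQv.IsHaarMeasure] [νQv.IsMulRightInvariant]
    {mQv : OrbitalMeasureFamily (Gqs L v)}
    (hcanQ : mQv.IsCanonical (fun γ => IsRegularElt (γ.val : GL (Fin 3) (UnitaryGroup.LocalRing L v))) νQv) :
    ∃ ϖ : w.1.adicCompletion L, Valued.v ϖ = WithZero.exp (-1 : ℤ) ∧
      ∀ (g₁ : GL (Fin 3) (w.1.adicCompletion L)),
        (g₁ : Matrix (Fin 3) (Fin 3) (w.1.adicCompletion L)) = Matrix.diagonal ![(1 : w.1.adicCompletion L), 1, ϖ] →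
      ∀ (K0 K1 I : Subgroup (Gqs L v)),
        K0 = ((glInt 3 (w.1.adicCompletion L)).subgroupOf
          (unitaryGroupOfForm (galAdicCompletionMap (L := L) (IsCMField.complexConj L) hw) ((StdForm.antidiagonal 3).over (w.1.adicCompletion L)))).comap
            eA.toMulEquiv.toMonoidHom →
        K1 = (((glInt 3 (w.1.adicCompletion L)).map (MulAut.conj g₁).toMonoidHom).subgroupOf
          (unitaryGroupOfForm (galAdicCompletionMap (L := L) (IsCMField.complexConj L) hw) ((StdForm.antidiagonal 3).over (w.1.adicCompletion L)))).comap
            eA.toMulEquiv.toMonoidHom →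
        I = K0 ⊓ K1 →
      ∀ (fG : Gqs L v → ℂ),
        (fG = fun g => (((νQv K0).toReal : ℂ))⁻¹ * (K0 : Set (Gqs L v)).indicator (fun _ => (1 : ℂ)) g +
          (((νQv K1).toReal : ℂ))⁻¹ * (K1 : Set (Gqs L v)).indicator (fun _ => (1 : ℂ)) g -
          (((νQv I).toReal : ℂ))⁻¹ * (I : Set (Gqs L v)).indicator (fun _ => (1 : ℂ)) g) →
        IsLocSmooth fG ∧ Measurable fG ∧ Integrable fG νQv ∧ ∫ g, fG g ∂νQv = 1 ∧ (fG 1).im = 0 ∧ (fG 1).re < 0 ∧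
          (∀ γ : Gqs L v, IsRegularElt (γ.val : GL (Fin 3) (UnitaryGroup.LocalRing L v)) →
            IsCompact ((Subgroup.centralizer ({γ} : Set (Gqs L v))) : Set (Gqs L v)) → classOrbitalIntegral mQv fG (ConjClasses.mk γ) = 1) ∧
          (∀ γ : Gqs L v, IsRegularElt (γ.val : GL (Fin 3) (UnitaryGroup.LocalRing L v)) →
            ¬ IsCompact ((Subgroup.centralizer ({γ} : Set (Gqs L v))) : Set (Gqs L v)) → classOrbitalIntegral mQv fG (ConjClasses.mk γ) = 0) := by
  by_cases he : v.asIdeal.ramificationIdx' w.1.asIdeal = 1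
  · -- unramified: the datum's uniformiser and ★ (G3)-EXPLICIT
    haveI : Algebra.IsQuadraticExtension ↥(maximalRealSubfield L) L := IsCMField.isQuadraticExtension L
    have hunr : Algebra.IsUnramifiedIn (𝓞 L) v.asIdeal :=
      isUnramifiedIn_of_ramificationIdx'_eq_one L (IsCMField.complexConj L) v (IsCMField.complexConj_ne_one L) w hw he
    obtain ⟨ϖ, hd⟩ := unramifiedLocalConjDatum_adicCompletion (IsCMField.complexConj L) (IsCMField.complexConj_ne_one L) v w hw hunr
    exact ⟨ϖ, hd.vϖ, fun g₁ hg₁ K0 K1 I hK0 hK1 hI fG hfG =>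
      epFunction_G_explicit L v hns hunr w hw hd g₁ hg₁ eA heA K0 K1 I hK0 hK1 hI νQv hcanQ fG hfG⟩
  · -- tame ramified: the block's uniformiser and ★ (G3)-EXPLICIT-RAM
    obtain ⟨ϖ, hϖ, hσϖ, hres, hnorm⟩ := ramifiedBlock_adicCompletion L v w hw he (hw2.resolve_left he)
    exact ⟨ϖ, hϖ, fun g₁ hg₁ K0 K1 I hK0 hK1 hI fG hfG =>
      epFunction_G_explicit_of_ramified L v hns w hw hϖ hσϖ hres (hw2.resolve_left he) hnorm g₁ hg₁ eA heA K0 K1 I hK0 hK1 hI νQv hcanQ fG hfG⟩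

/-! ## §2 The junction in `L⁺_v`-letters: unramified in `L` OR odd residue characteristic -/

set_option maxHeartbeats 1600000 in  -- statement-level `whnf` on the CM carriers + eight clauses, exactly as ★ (G3)-EXPLICIT `epFunction_G_explicit` and ★ (G3)-NOT-WILD §2 (measured there)
/-- **(G3)-EXPLICIT-NOT-WILD — ONE UNIFORMISER FOR ALL LETTERS AT EVERY NON-SPLIT PLACE THAT IS NOT WILDLY RAMIFIED** (`v` unramified in `L` OR `|2|_v = 1`; `w ∣ v` and the
one-place model `(eA, heA)` as binders because the letters live at `w`): there is a uniformiser `ϖ` of `L_w` (`|ϖ|_w = exp(−1)`) such that for every `g₁ = diag(1,1,ϖ)`,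
`K₀, K₁, I` (the three displays) and `fG = νQv(K₀)⁻¹𝟙_{K₀} + νQv(K₁)⁻¹𝟙_{K₁} − νQv(I)⁻¹𝟙_I` the eight clauses of ★ `epFunction_G_explicit` hold token for token.  §1 with
`|2|_v = 1 ↔ |2|_w = 1` (★ `valued_two_eq_one_iff_of_placesOver`) and, on the unramified branch, `e(w|v) = 1` read off `Algebra.IsUnramifiedIn` through the datum (★
`unramifiedLocalConjDatum_adicCompletion`, ★ `epFunction_G_explicit` directly).  The one name an EP-PAIRS assembly with head binder `Algebra.IsUnramifiedIn (𝓞 L) 𝔭_v ∨ |2|_v = 1`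
`obtain`s ONCE (LEAD T15-25 (b)(c)); the wildly ramified (dyadic ramified) places remain OPEN (census G-RAM §4).
[cite: Kottwitz1988, §2 Theorem 2] [cite: Rogawski1990, §12.6 p. 187] [cite: Tits1979, §2.4] -/
theorem exists_uniformizer_epFunction_G_explicit_of_not_wild (hns : ∀ w : PlacesOver L v, IsCMField.complexConj L • w.1 = w.1)
    (hv : Algebra.IsUnramifiedIn (𝓞 L) v.asIdeal ∨ Valued.v (2 : v.adicCompletion ↥(maximalRealSubfield L)) = 1)
    (w : PlacesOver L v) (hw : IsCMField.complexConj L • w.1 = w.1)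
    (eA : Gqs L v ≃ₜ* ↥(unitaryGroupOfForm (galAdicCompletionMap (L := L) (IsCMField.complexConj L) hw) ((StdForm.antidiagonal 3).over (w.1.adicCompletion L))))
    (heA : ∀ g : Gqs L v,
      ((eA g : ↥(unitaryGroupOfForm (galAdicCompletionMap (L := L) (IsCMField.complexConj L) hw) ((StdForm.antidiagonal 3).over (w.1.adicCompletion L)))) :
          GL (Fin 3) (w.1.adicCompletion L)) =
        ((localNonsplitEquiv (IsCMField.complexConj L) (qsForm L) (IsCMField.complexConj_ne_one L) w hw g :
          ↥(unitaryGroupOfForm (galAdicCompletionMap (L := L) (IsCMField.complexConj L) hw) (placeForm (qsForm L) w.1))) : GL (Fin 3) (w.1.adicCompletion L)))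
    [MeasurableSpace (Gqs L v)] [BorelSpace (Gqs L v)]
    [∀ γ : Gqs L v, MeasurableSpace (Gqs L v ⧸ Subgroup.centralizer ({γ} : Set (Gqs L v)))]
    [∀ γ : Gqs L v, BorelSpace (Gqs L v ⧸ Subgroup.centralizer ({γ} : Set (Gqs L v)))]
    (νQv : Measure (Gqs L v)) [νQv.IsHaarMeasure] [νQv.IsMulRightInvariant]
    {mQv : OrbitalMeasureFamily (Gqs L v)}
    (hcanQ : mQv.IsCanonical (fun γ => IsRegularElt (γ.val : GL (Fin 3) (UnitaryGroup.LocalRing L v))) νQv) :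
    ∃ ϖ : w.1.adicCompletion L, Valued.v ϖ = WithZero.exp (-1 : ℤ) ∧
      ∀ (g₁ : GL (Fin 3) (w.1.adicCompletion L)),
        (g₁ : Matrix (Fin 3) (Fin 3) (w.1.adicCompletion L)) = Matrix.diagonal ![(1 : w.1.adicCompletion L), 1, ϖ] →
      ∀ (K0 K1 I : Subgroup (Gqs L v)),
        K0 = ((glInt 3 (w.1.adicCompletion L)).subgroupOf
          (unitaryGroupOfForm (galAdicCompletionMap (L := L) (IsCMField.complexConj L) hw) ((StdForm.antidiagonal 3).over (w.1.adicCompletion L)))).comap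
            eA.toMulEquiv.toMonoidHom →
        K1 = (((glInt 3 (w.1.adicCompletion L)).map (MulAut.conj g₁).toMonoidHom).subgroupOf
          (unitaryGroupOfForm (galAdicCompletionMap (L := L) (IsCMField.complexConj L) hw) ((StdForm.antidiagonal 3).over (w.1.adicCompletion L)))).comap
            eA.toMulEquiv.toMonoidHom →
        I = K0 ⊓ K1 →
      ∀ (fG : Gqs L v → ℂ),
        (fG = fun g => (((νQv K0).toReal : ℂ))⁻¹ * (K0 : Set (Gqs L v)).indicator (fun _ => (1 : ℂ)) g +
          (((νQv K1).toReal : ℂ))⁻¹ * (K1 : Set (Gqs L v)).indicator (fun _ => (1 : ℂ)) g -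
          (((νQv I).toReal : ℂ))⁻¹ * (I : Set (Gqs L v)).indicator (fun _ => (1 : ℂ)) g) →
        IsLocSmooth fG ∧ Measurable fG ∧ Integrable fG νQv ∧ ∫ g, fG g ∂νQv = 1 ∧ (fG 1).im = 0 ∧ (fG 1).re < 0 ∧
          (∀ γ : Gqs L v, IsRegularElt (γ.val : GL (Fin 3) (UnitaryGroup.LocalRing L v)) →
            IsCompact ((Subgroup.centralizer ({γ} : Set (Gqs L v))) : Set (Gqs L v)) → classOrbitalIntegral mQv fG (ConjClasses.mk γ) = 1) ∧
          (∀ γ : Gqs L v, IsRegularElt (γ.val : GL (Fin 3) (UnitaryGroup.LocalRing L v)) →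
            ¬ IsCompact ((Subgroup.centralizer ({γ} : Set (Gqs L v))) : Set (Gqs L v)) → classOrbitalIntegral mQv fG (ConjClasses.mk γ) = 0) := by
  rcases hv with hunr | h2
  · -- unramified in `L⁺_v`-letters: the datum directly
    haveI : Algebra.IsQuadraticExtension ↥(maximalRealSubfield L) L := IsCMField.isQuadraticExtension L
    obtain ⟨ϖ, hd⟩ := unramifiedLocalConjDatum_adicCompletion (IsCMField.complexConj L) (IsCMField.complexConj_ne_one L) v w hw hunr
    exact ⟨ϖ, hd.vϖ, fun g₁ hg₁ K0 K1 I hK0 hK1 hI fG hfG =>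
      epFunction_G_explicit L v hns hunr w hw hd g₁ hg₁ eA heA K0 K1 I hK0 hK1 hI νQv hcanQ fG hfG⟩
  · exact exists_uniformizer_epFunction_G_explicit_of_ramificationIdx'_or_valued_two L v hns w hw
      (Or.inr ((valued_two_eq_one_iff_of_placesOver L w).2 h2)) eA heA νQv hcanQ

end Summit.HodgeConjecture.HodgeConjecture.Cruxes.H413.F0P3cStCharTSEPGlueGExplicitNotWild

end
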